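import Summits.QuantumFields.QCD.Theorems.WilsonMobilityGapMobilityGapStubLightMoment
import Literature.MathematicalPhysics.QuantumFieldTheory.QCDPropagatorParity

/-!
# Crux `MobilityGap` (stmt-QuantumFields-9150), line `Ideator6Sketch` (card `integer-pinch-unitary-point`) —
# the colour–spin block of the quark propagator: `fm … 2` IS the charged-pion correlator up to `144`
# (helper file, `--supports` 9150; fragment (c) of stub `stub_aokiLRO`, S3 of the line)

Stub `stub_aokiLRO` (S3) concludes with a volume-uniform pointwise LOWER bound on the phase-quenched SECOND
moment `fm N_f β (x,…,x) S f v 2 = ∫ (Σ_{a,i,b,j} |G_f((0,a,i),(v,b,j))|)² dμ₊` of the propagator entry sum at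
a degenerate bare tuple.  The card's mechanism reaches that quantity through the charged-pion two-point
function: for the DEGENERATE doublet the `π` correlator is the pure quark-line contraction
`tr[G(0,v) γ₅ G(v,0) γ₅]`, which γ₅-hermiticity turns into the Frobenius norm `‖G(0,v)‖²_F` of the colour–spin
block.  This file makes that dictionary entry kernel-checked on the tree's own objects:

* §1 `star_inv_wilsonDirac_apply` (`conj G(p,q) = ε_q G(q,p) ε_p`, `ε = (1,1,-1,-1)`, from the tree's
  `wilsonDirac_gammaFive_hermitian_holds` via `conjTranspose_inv_of_signConj`); the equal-mass contraction
  `pionContraction U m m x y` of `QCD.lean` is REAL and its real part is `Σ_{a,α,b,β} |G((x,a,α),(y,b,β))|²`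
  (`re_pionContraction_self`, `im_pionContraction_self`; the six-fold-sum identity itself is kept `private` —
  it is the sibling route's open item `IntegerCriticalLine.PionContractionEqNormSq`, stmt-QuantumFields-10518,
  which this file does not close); measurability in the gauge field.
* §2 the BLOCK IDENTITY `propSum_const_eq`: at a degenerate tuple the `N_f`-flavour entry sum `propSum` is the
  colour–spin block sum of the one-flavour propagator `D_W(U,x,1)⁻¹` (flavour-diagonal `diracMatrix`; both
  Mathlib inverses vanish together where `D_W(x)` is singular), and the `ℓ¹/ℓ²` comparison on the 144 entries:
  `Re tr[Gγ₅Gγ₅](0,v) ≤ propSum² ≤ 144 · Re tr[Gγ₅Gγ₅](0,v)` configuration-wise (`propSum_sq_pion_sandwich`).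
* §3 FRAGMENT (c) `fm_two_pionCorrelator_sandwich`: integrating against the phase-quenched probability measure
  `qcdLatticeMeasure (2S+1) β (x,…,x)` (`fm_eq_integral`), for every flavour pair `g, g'`
  `-Re S_π^{gg'}(0,v) ≤ fm … 2 ≤ -144 · Re S_π^{gg'}(0,v)` with `S_π = pionCorrelator` the honest lattice pion
  two-point function of `QCD.lean` (`= -∫ tr[Gγ₅Gγ₅] dμ₊`, real here: `pionCorrelator_const_eq`); the
  non-integrable case is the Bochner junk `0 = 0` on both sides.  So LONG-RANGE ORDER of the charged-pion
  correlator at some bare mass `x > -1`, uniformly in the volume, is exactly the second-moment lower bound the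
  stub needs — and is the open input (Aoki-phase LRO along `β_k → ∞`; no supplier in the tree or in print for
  the Wilson action as typed).
-/

noncomputable section

namespace Summit.QuantumFields.QCD.Theorems.MobilityGapPinch

open scoped BigOperators Topology ComplexConjugate
open MeasureTheory Filter Set Matrix Complex
open Literature.MathematicalPhysics.QuantumFieldTheory Literature.MathematicalPhysics.QuantumLattice
  Literature.Probability.LatticeModels
open Summit.QuantumFields.QCD.Theorems.MobilityGapSketch

/-! ### §1 γ₅-hermiticity of the propagator and the equal-mass pion contraction -/

section Torus

variable {L : ℕ} [NeZero L]

/-- γ₅-hermiticity of the Wilson quark propagator, entrywise: `conj G(p,q) = ε_q G(q,p) ε_p` with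
`ε = (1,1,-1,-1)` the chiral signs (`G = D_W(U,m,1)⁻¹`, Mathlib's inverse). -/
theorem star_inv_wilsonDirac_apply (U : GaugeConfig 4 L SU3) (m : ℝ) (p q : TorusSite 4 L × Fin 3 × Fin 4) :
    star ((wilsonDirac (fundamentalRep (Fin 3)) U m 1)⁻¹ p q) =
      (![1, 1, -1, -1] : Fin 4 → ℂ) q.2.2 * (wilsonDirac (fundamentalRep (Fin 3)) U m 1)⁻¹ q p *
        (![1, 1, -1, -1] : Fin 4 → ℂ) p.2.2 := by
  have hΓ : diagonal (fun i : TorusSite 4 L × Fin 3 × Fin 4 => (![1, 1, -1, -1] : Fin 4 → ℂ) i.2.2) *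
      wilsonDirac (fundamentalRep (Fin 3)) U m 1 *
        diagonal (fun i => (![1, 1, -1, -1] : Fin 4 → ℂ) i.2.2) =
      (wilsonDirac (fundamentalRep (Fin 3)) U m 1)ᴴ := by
    rw [← spinorLift_gammaFive_eq_diagonal]
    exact wilsonDirac_gammaFive_hermitian_holds (fundamentalRep (Fin 3)) fundamentalRep_mem_unitaryGroup U m 1
  have h := conjTranspose_inv_of_signConj
    (fun i : TorusSite 4 L × Fin 3 × Fin 4 => (![1, 1, -1, -1] : Fin 4 → ℂ) i.2.2)
    (fun i => gammaFiveSign_mul_self i.2.2) (wilsonDirac (fundamentalRep (Fin 3)) U m 1) hΓ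
  have h' := congr_fun (congr_fun h q) p
  rw [conjTranspose_apply, mul_diagonal, diagonal_mul] at h'
  exact h'

/-- `G(p,q) · ε_{q} G(q,p) ε_{p} = |G(p,q)|²` (γ₅-hermiticity). -/
theorem inv_wilsonDirac_mul_swap (U : GaugeConfig 4 L SU3) (m : ℝ) (p q : TorusSite 4 L × Fin 3 × Fin 4) :
    (wilsonDirac (fundamentalRep (Fin 3)) U m 1)⁻¹ p q * (![1, 1, -1, -1] : Fin 4 → ℂ) q.2.2 *
        (wilsonDirac (fundamentalRep (Fin 3)) U m 1)⁻¹ q p * (![1, 1, -1, -1] : Fin 4 → ℂ) p.2.2 =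
      ((‖(wilsonDirac (fundamentalRep (Fin 3)) U m 1)⁻¹ p q‖ ^ 2 : ℝ) : ℂ) := by
  rw [mul_assoc, mul_assoc, ← mul_assoc ((![1, 1, -1, -1] : Fin 4 → ℂ) q.2.2),
    ← star_inv_wilsonDirac_apply U m p q, Complex.star_def, Complex.mul_conj, Complex.normSq_eq_norm_sq]

/-- The equal-mass pseudoscalar contraction is the Frobenius norm of the colour–spin block:
`tr[G(x,y) γ₅ G(y,x) γ₅] = Σ_{a,α,b,β} |G((x,a,α),(y,b,β))|²` (private: the six-fold sum form is the
sibling route's item `IntegerCriticalLine.PionContractionEqNormSq`, stmt-QuantumFields-10518, which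
this file does not close). -/
private theorem pionContraction_self_eq (U : GaugeConfig 4 L SU3) (m : ℝ) (x y : TorusSite 4 L) :
    pionContraction U m m x y =
      ((∑ a : Fin 3, ∑ α : Fin 4, ∑ b : Fin 3, ∑ β : Fin 4,
        ‖(wilsonDirac (fundamentalRep (Fin 3)) U m 1)⁻¹ (x, a, α) (y, b, β)‖ ^ 2 : ℝ) : ℂ) := by
  have hγ : ∀ i j : Fin 4, gammaFive i j = if i = j then (![1, 1, -1, -1] : Fin 4 → ℂ) i else 0 := by
    intro i j
    rw [gammaFive_eq_diagonal, diagonal_apply]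
  -- the two `γ₅` insertions collapse the inner double sum
  have inner : ∀ (G1 : ℂ) (G2 : Fin 4 → Fin 4 → ℂ) (α β : Fin 4),
      ∑ α' : Fin 4, ∑ β' : Fin 4, G1 * gammaFive β β' * G2 β' α' * gammaFive α' α =
        G1 * (![1, 1, -1, -1] : Fin 4 → ℂ) β * G2 β α * (![1, 1, -1, -1] : Fin 4 → ℂ) α := by
    intro G1 G2 α β
    rw [Finset.sum_eq_single α, Finset.sum_eq_single β]
    · simp [hγ]
    · intro β' _ hβ'
      simp [hγ, Ne.symm hβ']
    · intro h; exact absurd (Finset.mem_univ β) h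
    · intro α' _ hα'
      exact Finset.sum_eq_zero fun β' _ => by simp [hγ, hα']
    · intro h; exact absurd (Finset.mem_univ α) h
  unfold pionContraction quarkPropagator
  push_cast
  refine Finset.sum_congr rfl fun a _ => ?_
  rw [Finset.sum_comm]
  refine Finset.sum_congr rfl fun α _ => Finset.sum_congr rfl fun b _ =>
    Finset.sum_congr rfl fun β _ => ?_
  rw [inner, inv_wilsonDirac_mul_swap U m (x, a, α) (y, b, β)]
  push_cast
  rfl

/-- **The equal-mass pion contraction is real and equals the block Frobenius norm (real part).** -/
theorem re_pionContraction_self (U : GaugeConfig 4 L SU3) (m : ℝ) (x y : TorusSite 4 L) :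
    (pionContraction U m m x y).re =
      ∑ a : Fin 3, ∑ α : Fin 4, ∑ b : Fin 3, ∑ β : Fin 4,
        ‖(wilsonDirac (fundamentalRep (Fin 3)) U m 1)⁻¹ (x, a, α) (y, b, β)‖ ^ 2 := by
  rw [pionContraction_self_eq, Complex.ofReal_re]

/-- The equal-mass pion contraction has no imaginary part. -/
theorem im_pionContraction_self (U : GaugeConfig 4 L SU3) (m : ℝ) (x y : TorusSite 4 L) :
    (pionContraction U m m x y).im = 0 := by
  rw [pionContraction_self_eq, Complex.ofReal_im]

/-- The equal-mass pion contraction is the cast of its (non-negative) real part. -/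
theorem pionContraction_self_eq_ofReal (U : GaugeConfig 4 L SU3) (m : ℝ) (x y : TorusSite 4 L) :
    pionContraction U m m x y = ((pionContraction U m m x y).re : ℂ) :=
  Complex.ext (by simp) (by simp [im_pionContraction_self])

/-- `0 ≤ Re tr[G γ₅ G γ₅]` at equal masses. -/
theorem re_pionContraction_self_nonneg (U : GaugeConfig 4 L SU3) (m : ℝ) (x y : TorusSite 4 L) :
    0 ≤ (pionContraction U m m x y).re := by
  rw [re_pionContraction_self]
  positivity

/-- Every propagator entry `U ↦ D_W(U,m,1)⁻¹(p,q)` is a measurable function of the gauge field. -/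
theorem measurable_inv_wilsonDirac_apply (m : ℝ) (p q : TorusSite 4 L × Fin 3 × Fin 4) :
    Measurable fun U : GaugeConfig 4 L SU3 => (wilsonDirac (fundamentalRep (Fin 3)) U m 1)⁻¹ p q := by
  have hc : Continuous fun U : GaugeConfig 4 L SU3 => wilsonDirac (fundamentalRep (Fin 3)) U m 1 :=
    continuous_wilsonDirac (fundamentalRep (Fin 3)) (continuous_fundamentalRep (Fin 3)) m 1
  have h1 : (fun U : GaugeConfig 4 L SU3 => (wilsonDirac (fundamentalRep (Fin 3)) U m 1)⁻¹ p q) =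
      fun U => ((wilsonDirac (fundamentalRep (Fin 3)) U m 1).det)⁻¹ *
        (wilsonDirac (fundamentalRep (Fin 3)) U m 1).adjugate p q := by
    funext U
    rw [Matrix.inv_def, Matrix.smul_apply, smul_eq_mul, Ring.inverse_eq_inv']
  rw [h1]
  exact hc.matrix_det.measurable.inv.mul ((hc.matrix_adjugate.matrix_elem p q).measurable)

/-- The equal-mass pion contraction is a measurable function of the gauge field (real part). -/
theorem measurable_re_pionContraction_self (m : ℝ) (x y : TorusSite 4 L) :
    Measurable fun U : GaugeConfig 4 L SU3 => (pionContraction U m m x y).re := by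
  simp_rw [re_pionContraction_self]
  refine Finset.measurable_sum _ fun a _ => Finset.measurable_sum _ fun α _ =>
    Finset.measurable_sum _ fun b _ => Finset.measurable_sum _ fun β _ => ?_
  exact (measurable_inv_wilsonDirac_apply m _ _).norm.pow_const 2

end Torus

/-! ### §2 The entry sum `propSum` at a degenerate tuple and the `ℓ¹/ℓ²` comparison -/

/-- **Block identity.** At a degenerate bare tuple `(x,…,x)` the entry sum of the `N_f`-flavour
propagator is the colour–spin block sum of the ONE-flavour Wilson propagator `D_W(U,x,1)⁻¹`
(flavour-diagonal `diracMatrix`; where `D_W(x)` is singular both Mathlib inverses vanish). -/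
theorem propSum_const_eq {Nf S : ℕ} (x : ℝ) (f : Fin Nf) (v : Literature.Probability.LatticeModels.Site 4)
    (U : GaugeConfig 4 (2 * S + 1) SU3) :
    propSum Nf S (fun _ => x) f v U = ∑ a : Fin 3, ∑ i : Fin 4, ∑ b : Fin 3, ∑ j : Fin 4,
      ‖(wilsonDirac (fundamentalRep (Fin 3)) U x 1)⁻¹ (Torus.proj (2 * S + 1) 0, a, i)
        (Torus.proj (2 * S + 1) v, b, j)‖ := by
  unfold propSum
  by_cases hdet : (wilsonDirac (fundamentalRep (Fin 3)) U x 1).det ≠ 0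
  · simp_rw [inv_diracMatrix_apply_same_flavour U (fun _ : Fin Nf => x) (fun _ => hdet) f]
  · push Not at hdet
    have h0 : (diracMatrix U (fun _ : Fin Nf => x)).det = 0 := by
      rw [det_diracMatrix]
      exact Finset.prod_eq_zero (Finset.mem_univ f) hdet
    have h1 : (diracMatrix U (fun _ : Fin Nf => x))⁻¹ = 0 :=
      Matrix.nonsing_inv_apply_not_isUnit _ (by rw [h0]; exact not_isUnit_zero)
    have h2 : (wilsonDirac (fundamentalRep (Fin 3)) U x 1)⁻¹ = 0 :=
      Matrix.nonsing_inv_apply_not_isUnit _ (by rw [hdet]; exact not_isUnit_zero)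
    simp [h1, h2]

/-- A fourfold sum as a sum over the product index type. -/
private theorem sum_four_eq_sum_prod {γ : Type*} [AddCommMonoid γ] (g : Fin 3 → Fin 4 → Fin 3 → Fin 4 → γ) :
    ∑ a, ∑ i, ∑ b, ∑ j, g a i b j = ∑ k : Fin 3 × Fin 4 × Fin 3 × Fin 4, g k.1 k.2.1 k.2.2.1 k.2.2.2 := by
  symm
  calc ∑ k : Fin 3 × Fin 4 × Fin 3 × Fin 4, g k.1 k.2.1 k.2.2.1 k.2.2.2
      = ∑ a : Fin 3, ∑ q : Fin 4 × Fin 3 × Fin 4, g a q.1 q.2.1 q.2.2 :=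
        Fintype.sum_prod_type' (fun (a : Fin 3) (q : Fin 4 × Fin 3 × Fin 4) => g a q.1 q.2.1 q.2.2)
    _ = ∑ a : Fin 3, ∑ i : Fin 4, ∑ r : Fin 3 × Fin 4, g a i r.1 r.2 :=
        Finset.sum_congr rfl fun a _ =>
          Fintype.sum_prod_type' (fun (i : Fin 4) (r : Fin 3 × Fin 4) => g a i r.1 r.2)
    _ = ∑ a : Fin 3, ∑ i : Fin 4, ∑ b : Fin 3, ∑ j : Fin 4, g a i b j :=
        Finset.sum_congr rfl fun a _ => Finset.sum_congr rfl fun i _ =>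
          Fintype.sum_prod_type' (fun (b : Fin 3) (j : Fin 4) => g a i b j)

/-- `ℓ¹/ℓ²` comparison on the 144 colour–spin entries: `Σ g² ≤ (Σ g)² ≤ 144 Σ g²` for `g ≥ 0`. -/
theorem sum_sq_le_sq_sum_le (g : Fin 3 → Fin 4 → Fin 3 → Fin 4 → ℝ) (hg : ∀ a i b j, 0 ≤ g a i b j) :
    ∑ a, ∑ i, ∑ b, ∑ j, g a i b j ^ 2 ≤ (∑ a, ∑ i, ∑ b, ∑ j, g a i b j) ^ 2 ∧
      (∑ a, ∑ i, ∑ b, ∑ j, g a i b j) ^ 2 ≤ 144 * ∑ a, ∑ i, ∑ b, ∑ j, g a i b j ^ 2 := by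
  rw [sum_four_eq_sum_prod g, sum_four_eq_sum_prod (fun a i b j => g a i b j ^ 2)]
  refine ⟨Finset.sum_sq_le_sq_sum_of_nonneg fun k _ => hg _ _ _ _, ?_⟩
  have h := sq_sum_le_card_mul_sum_sq (s := (Finset.univ : Finset (Fin 3 × Fin 4 × Fin 3 × Fin 4)))
    (f := fun k => g k.1 k.2.1 k.2.2.1 k.2.2.2)
  have hcard : ((Finset.univ : Finset (Fin 3 × Fin 4 × Fin 3 × Fin 4)).card : ℝ) = 144 := by simp
  rw [hcard] at h
  exact h

/-- **Fragment (c), configuration-wise.** At a degenerate tuple the squared entry sum — the `s = 2`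
integrand of `fm`/`propSum` — is the charged-pion contraction up to the `ℓ¹/ℓ²` constant:
`Re tr[G(0,v)γ₅G(v,0)γ₅] ≤ (Σ_{a,i,b,j}|G((0,a,i),(v,b,j))|)² ≤ 144 · Re tr[G(0,v)γ₅G(v,0)γ₅]`,
`G = D_W(U,x,1)⁻¹`, for every gauge field. -/
theorem propSum_sq_pion_sandwich {Nf S : ℕ} (x : ℝ) (f : Fin Nf) (v : Literature.Probability.LatticeModels.Site 4)
    (U : GaugeConfig 4 (2 * S + 1) SU3) :
    (pionContraction U x x (Torus.proj (2 * S + 1) 0) (Torus.proj (2 * S + 1) v)).re ≤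
        propSum Nf S (fun _ => x) f v U ^ 2 ∧
      propSum Nf S (fun _ => x) f v U ^ 2 ≤
        144 * (pionContraction U x x (Torus.proj (2 * S + 1) 0) (Torus.proj (2 * S + 1) v)).re := by
  rw [re_pionContraction_self, propSum_const_eq]
  exact sum_sq_le_sq_sum_le _ fun _ _ _ _ => norm_nonneg _

/-! ### §3 The second moment `fm … 2` and the phase-quenched pion correlator -/

/-- At a degenerate tuple the lattice pion correlator of ANY flavour pair is minus the phase-quenched
average of the equal-mass contraction, a real number:
`S_π(0,v) = -∫ Re tr[G(0,v)γ₅G(v,0)γ₅] dμ₊` (Bochner junk `0` on both sides if non-integrable). -/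
theorem pionCorrelator_const_eq {Nf S : ℕ} (β x : ℝ) (g g' : Fin Nf) (p q : TorusSite 4 (2 * S + 1)) :
    pionCorrelator (2 * S + 1) β (fun _ : Fin Nf => x) g g' p q =
      -((∫ U, (pionContraction U x x p q).re ∂(qcdLatticeMeasure (2 * S + 1) β (fun _ : Fin Nf => x)) : ℝ) : ℂ) := by
  rw [pionCorrelator_def, ← integral_complex_ofReal]
  congr 1
  refine integral_congr_ae (Eventually.of_forall fun U => ?_)
  exact pionContraction_self_eq_ofReal U x p q

/-- **Fragment (c), averaged.** For every `N_f`, coupling `β`, degenerate tuple `(x,…,x)`, torus of side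
`2S+1`, flavours `f, g, g'` and displacement `v`, the phase-quenched SECOND moment of the propagator entry
sum is the charged-pion correlator up to the `ℓ¹/ℓ²` constant `144`:
`-Re S_π^{g g'}(0,v) ≤ fm N_f β (x,…,x) S f v 2 ≤ -144 · Re S_π^{g g'}(0,v)`,
`S_π = pionCorrelator (2S+1) β (x,…,x) g g'` (the honest integral `-∫ tr[GΓ₅GΓ₅] dμ₊` of `QCD.lean`
against the phase-quenched probability measure `qcdLatticeMeasure`).  So long-range order of the
charged-pion correlator IS a volume-uniform lower bound on `fm … 2` — the input stub `stub_aokiLRO`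
needs at the unitary point. -/
theorem fm_two_pionCorrelator_sandwich : ∀ (Nf S : ℕ) (β x : ℝ) (f g g' : Fin Nf) (v : Literature.Probability.LatticeModels.Site 4), -(pionCorrelator (2 * S + 1) β (fun _ : Fin Nf => x) g g' (Torus.proj (2 * S + 1) 0) (Torus.proj (2 * S + 1) v)).re ≤ fm Nf β (fun _ => x) S f v 2 ∧ fm Nf β (fun _ => x) S f v 2 ≤ -(144 * (pionCorrelator (2 * S + 1) β (fun _ : Fin Nf => x) g g' (Torus.proj (2 * S + 1) 0) (Torus.proj (2 * S + 1) v)).re) := by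
  intro Nf S β x f g g' v
  set μ := qcdLatticeMeasure (2 * S + 1) β (fun _ : Fin Nf => x) with hμ
  set Q : GaugeConfig 4 (2 * S + 1) SU3 → ℝ :=
    fun U => (pionContraction U x x (Torus.proj (2 * S + 1) 0) (Torus.proj (2 * S + 1) v)).re with hQ
  set P : GaugeConfig 4 (2 * S + 1) SU3 → ℝ := fun U => propSum Nf S (fun _ => x) f v U ^ 2 with hP
  have hcorr : (pionCorrelator (2 * S + 1) β (fun _ : Fin Nf => x) g g' (Torus.proj (2 * S + 1) 0)
      (Torus.proj (2 * S + 1) v)).re = -∫ U, Q U ∂μ := by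
    rw [pionCorrelator_const_eq, Complex.neg_re, Complex.ofReal_re]
  have hfm : fm Nf β (fun _ => x) S f v 2 = ∫ U, P U ∂μ := by
    rw [fm_eq_integral]
    refine integral_congr_ae (Eventually.of_forall fun U => ?_)
    simp only [hP, Real.rpow_two]
  have hQP : ∀ U, Q U ≤ P U := fun U => (propSum_sq_pion_sandwich x f v U).1
  have hPQ : ∀ U, P U ≤ 144 * Q U := fun U => (propSum_sq_pion_sandwich x f v U).2
  have hQ0 : ∀ U, 0 ≤ Q U := fun U => re_pionContraction_self_nonneg U x _ _
  have hQm : Measurable Q := measurable_re_pionContraction_self x _ _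
  have hPm : Measurable P := (measurable_propSum Nf S (fun _ => x) f v).pow_const 2
  rw [hcorr, hfm, neg_neg, neg_mul_eq_mul_neg, neg_neg]
  by_cases hPi : Integrable P μ
  · have hQi : Integrable Q μ :=
      Integrable.mono' hPi hQm.aestronglyMeasurable (Eventually.of_forall fun U => by
        rw [Real.norm_eq_abs, abs_of_nonneg (hQ0 U)]; exact hQP U)
    refine ⟨integral_mono hQi hPi hQP, ?_⟩
    calc ∫ U, P U ∂μ ≤ ∫ U, 144 * Q U ∂μ := integral_mono hPi (hQi.const_mul 144) hPQ
      _ = 144 * ∫ U, Q U ∂μ := integral_const_mul _ _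
  · have hQi : ¬ Integrable Q μ := by
      intro hQi
      exact hPi (Integrable.mono' (hQi.const_mul 144) hPm.aestronglyMeasurable
        (Eventually.of_forall fun U => by
          rw [Real.norm_eq_abs, abs_of_nonneg (sq_nonneg _ |>.trans_eq' ?_)]
          · exact hPQ U
          · rfl))
    rw [integral_undef hPi, integral_undef hQi, mul_zero]
    exact ⟨le_rfl, le_rfl⟩

end Summit.QuantumFields.QCD.Theorems.MobilityGapPinch

end
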